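import Literature.Geometry.Lorentzian.KerrSeparatedTrapping
import HarnessLib

/-!
# The extremal-threshold corner of the critical-point cubic of Carter's potential `V₀`

(family `gr`, infrastructure for statement **gr.S24**; namespace `Literature.Geometry.Lorentzian.Kerr`)

Dafermos–Rodnianski–Shlapentokh-Rothman, *Decay for solutions of the wave equation on Kerr
exterior spacetimes III*, arXiv:1402.7034 = Ann. of Math. 183 (2016), control the critical points
of the frequency-dependent part `V₀ = (4Mramω − a²m² + ΔΛ)/(r² + a²)²` of Carter's potential
(§6.2) through the cubic
`P(r) = (r² + a²)³ dV₀/dr = 4maMω(−3r² + a²) + 4ra²m² − 2Λ(r³ + a²r − 3Mr² + Ma²)`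
of the proof of Lemma 6.3.1 (`Kerr.critPoly`, `Kerr.deriv_sepPotential₀_eq` of
`KerrSeparatedTrapping.lean`, where the subextremal trichotomy of Lemma 6.3.1 is proved). This
file records the elementary algebra of `P` and `V₀` at the **extremal-threshold corner**
`a = M`, `ω = ω₊m = m/(2M)` of parameter/frequency space — the vertex of the near-extremal
threshold cone `a → M`, `ω → mω₊` — where everything is explicit:

* `critPoly_corner`: the cubic factors through the degenerate horizon `r₊ = M`:
  `P(r) = −2(r − M)·B(r)` with the **corner quadratic**
  `B(r) = Λr² + (3m² − 2Λ)Mr + (m² − Λ)M² = Λ(r − M)² + 3m²M(r − M) + 2M²(2m² − Λ)`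
  (`cornerQuad_eq`); so `B(M) = 2M²(2m² − Λ)` (`cornerQuad_self`),
  `B((1 + √2)M) = (4 + 3√2)m²M²` (`cornerQuad_trappingRadius`), and `B` is strictly increasing
  on `[M, ∞)` when `Λ > 0` (`cornerQuad_lt_cornerQuad`);
* `critPoly_corner_neg_of_le`: if `0 ≤ Λ ≤ 2m²` and `m ≠ 0` then `P < 0` on `(M, ∞)`: at the
  corner `V₀` is strictly decreasing on the whole exterior (`deriv_sepPotential₀_corner_neg`,
  `strictAntiOn_sepPotential₀_corner`) — no potential barrier away from the degenerate horizon;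
* `critPoly_corner_sign_of_lt`: if `Λ > 2m²` there is `r_c ∈ (M, (1 + √2)M]` — the larger root
  of `B` — with `P > 0` on `(M, r_c)`, `P(r_c) = 0`, `P < 0` on `(r_c, ∞)`; so `V₀` increases
  strictly on `(M, r_c]` and decreases strictly on `[r_c, ∞)`, a single barrier with its top at
  `r_c` (`sepPotential₀_corner_deriv_sign`, `sepPotential₀_corner_strictMonoOn_strictAntiOn`);
* `sq_sub_sepPotential₀_corner`: the threshold energy minus the potential factors through
  `Δ = (r − M)²`: `(ω₊m)² − V₀(r) = (r − M)²·(m²((r + M)² + 4M²) − 4M²Λ)/(4M²(r² + M²)²)`; its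
  value at `r = M` exhibits the same dividing line,
  `(ω₊m)² − V₀(r) = (2m² − Λ)(r − M)²/(4M⁴) + O((r − M)³)`, and for `Λ ≤ 2m²`, `m ≠ 0` the
  threshold frequency is nowhere trapped: `V₀ < (ω₊m)²` on `(M, ∞)` (`sepPotential₀_corner_lt_sq`).

The dividing line `Λ = 2m²`. In the tortoise variable (`r* ≈ −2M²/(r − M)` at `a = M`) the last
expansion reads `(ω₊m)² − V = (2m² − Λ)/r*² + O(|r*|⁻³)` as `r* → −∞`: `Λ = 2m²` is where the
inverse-square tail of the extremal near-horizon throat changes from attractive to repulsive. In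
terms of the Euler index `δ² = 7m²/4 − ¼ − λ` of the regular-singular face `r = M` of the
threshold radial Teukolsky equation (`ExtremalKerrThresholdRadial.lean`; the separation constants
are related by `Λ = λ + a²ω²`, i.e. `Λ = λ + m²/4` at the corner, so `δ² = 2m² − ¼ − Λ`) the line
`Λ = 2m²` is `δ² = −¼`, one Langer quarter below the Breitenlohner–Freedman threshold `δ² = 0` of
the `AdS₂` throat of extreme Kerr (Bardeen–Horowitz 1999; Amsel–Horowitz–Marolf–Roberts 2009):
every BF-violating sector `δ² > 0` lies on the barrier-free side `Λ < 2m²`, and every sector with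
a corner barrier (`Λ > 2m²`) is BF-stable. Away from the corner (`|a| < M`, `ω ≠ mω₊`) the cubic
acquires corrections `O(M − a) + O(|ω − mω₊|)` and the sign analysis is the subextremal
`Kerr.sepPotential₀_trichotomy`. Only the algebra and one-variable calculus are formalised here;
the throat interpretation is commentary.

## References

* M. Dafermos, I. Rodnianski, Y. Shlapentokh-Rothman, arXiv:1402.7034 = Ann. of Math. 183 (2016),
  §6.2 (`V₀`), Lemma 6.3.1 and its proof (the cubic `P`), Lemma 6.4.2, Lemma 6.5.1 (the radius
  `(1 + √2)M`) (key `DafermosRodnianskiShlapentokhrothman2014`).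
* J. Bardeen, G. Horowitz, Phys. Rev. D 60 (1999) 104030 (the extreme Kerr throat); A. Amsel,
  G. Horowitz, D. Marolf, M. Roberts, JHEP 09 (2009) 044 (the BF bound for the `(ℓ, m)` sectors of
  the throat) — context only, not formalised.
-/

noncomputable section

namespace Literature.Geometry.Lorentzian

namespace Kerr

open Set

/-! ### The corner quadratic `B(r) = Λr² + (3m² − 2Λ)Mr + (m² − Λ)M²` -/

/-- `B` recentred at the degenerate horizon: `B(r) = Λ(r − M)² + 3m²M(r − M) + 2M²(2m² − Λ)`.
[folklore] -/
theorem cornerQuad_eq (M Λ r : ℝ) (m : ℤ) :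
    Λ * r ^ 2 + (3 * (m : ℝ) ^ 2 - 2 * Λ) * M * r + ((m : ℝ) ^ 2 - Λ) * M ^ 2 =
      Λ * (r - M) ^ 2 + 3 * (m : ℝ) ^ 2 * M * (r - M) + 2 * M ^ 2 * (2 * (m : ℝ) ^ 2 - Λ) := by
  ring

/-- `B(M) = 2M²(2m² − Λ)`: the sign of `B` at the horizon is that of `2m² − Λ`. [folklore] -/
theorem cornerQuad_self (M Λ : ℝ) (m : ℤ) :
    Λ * M ^ 2 + (3 * (m : ℝ) ^ 2 - 2 * Λ) * M * M + ((m : ℝ) ^ 2 - Λ) * M ^ 2 =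
      2 * M ^ 2 * (2 * (m : ℝ) ^ 2 - Λ) := by
  ring

/-- `B((1 + √2)M) = (4 + 3√2)m²M² ≥ 0` (using `(1 + √2)² = 3 + 2√2`): the `Λ`-terms cancel at
DRSR's radius `(1 + √2)M` of Lemma 6.5.1. [folklore] -/
theorem cornerQuad_trappingRadius (M Λ : ℝ) (m : ℤ) :
    Λ * ((1 + Real.sqrt 2) * M) ^ 2 + (3 * (m : ℝ) ^ 2 - 2 * Λ) * M * ((1 + Real.sqrt 2) * M) +
        ((m : ℝ) ^ 2 - Λ) * M ^ 2 = (4 + 3 * Real.sqrt 2) * (m : ℝ) ^ 2 * M ^ 2 := by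
  have h2 : Real.sqrt 2 ^ 2 = 2 := Real.sq_sqrt (by norm_num)
  linear_combination Λ * M ^ 2 * h2

/-- `B(r) − B(s) = (r − s)(Λ(r + s − 2M) + 3m²M)`. [folklore] -/
theorem cornerQuad_sub (M Λ r s : ℝ) (m : ℤ) :
    (Λ * r ^ 2 + (3 * (m : ℝ) ^ 2 - 2 * Λ) * M * r + ((m : ℝ) ^ 2 - Λ) * M ^ 2) -
        (Λ * s ^ 2 + (3 * (m : ℝ) ^ 2 - 2 * Λ) * M * s + ((m : ℝ) ^ 2 - Λ) * M ^ 2) =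
      (r - s) * (Λ * (r + s - 2 * M) + 3 * (m : ℝ) ^ 2 * M) := by
  ring

/-- For `Λ > 0` and `M ≥ 0`, `B` is strictly increasing on `[M, ∞)`: `B(s) < B(r)` for
`M ≤ s < r`. [folklore] -/
theorem cornerQuad_lt_cornerQuad {M Λ r s : ℝ} (m : ℤ) (hM : 0 ≤ M) (hΛ : 0 < Λ) (hs : M ≤ s)
    (hsr : s < r) :
    Λ * s ^ 2 + (3 * (m : ℝ) ^ 2 - 2 * Λ) * M * s + ((m : ℝ) ^ 2 - Λ) * M ^ 2 <
      Λ * r ^ 2 + (3 * (m : ℝ) ^ 2 - 2 * Λ) * M * r + ((m : ℝ) ^ 2 - Λ) * M ^ 2 := by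
  have h1 : 0 < r - s := sub_pos.2 hsr
  have h2 : 0 < Λ * (r + s - 2 * M) + 3 * (m : ℝ) ^ 2 * M := by
    have : 0 < r + s - 2 * M := by linarith
    positivity
  have h3 := mul_pos h1 h2
  rw [← cornerQuad_sub] at h3
  exact sub_pos.1 h3

/-! ### The corner factorisation of the cubic and its sign -/

/-- **The cubic at the extremal-threshold corner.** At `a = M`, `ω = ω₊m = m/(2M)` DRSR's
critical-point cubic factors through the degenerate horizon `r = M`:
`P(r) = −2(r − M)(Λr² + (3m² − 2Λ)Mr + (m² − Λ)M²)` (no hypothesis on `M`: for `M = 0` both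
sides are `−2Λr³`, Mathlib's `m/0 = 0`). DRSR arXiv:1402.7034, proof of Lemma 6.3.1 (first
display), specialised. [cite: DafermosRodnianskiShlapentokhrothman2014, Lemma 6.3.1 (proof)] -/
theorem critPoly_corner (M Λ r : ℝ) (m : ℤ) :
    critPoly M M (m / (2 * M)) m Λ r =
      -2 * (r - M) * (Λ * r ^ 2 + (3 * (m : ℝ) ^ 2 - 2 * Λ) * M * r + ((m : ℝ) ^ 2 - Λ) * M ^ 2) := by
  unfold critPoly
  rcases eq_or_ne M 0 with rfl | hM
  · ring
  · field_simp
    ring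

/-- **Below the dividing line: no critical point.** For `0 < M`, `0 ≤ Λ ≤ 2m²`, `m ≠ 0` the corner
cubic is negative on the whole exterior `r > M` (`B(r) = Λ(r − M)² + 3m²M(r − M) + 2M²(2m² − Λ) > 0`
there), i.e. `dV₀/dr < 0` on `(M, ∞)` (`deriv_sepPotential₀_corner_neg`). DRSR arXiv:1402.7034,
proof of Lemma 6.3.1, specialised to `a = M`, `ω = m/(2M)`.
[cite: DafermosRodnianskiShlapentokhrothman2014, Lemma 6.3.1 (proof)] -/
theorem critPoly_corner_neg_of_le {M Λ r : ℝ} {m : ℤ} (hM : 0 < M) (hΛ0 : 0 ≤ Λ)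
    (hΛ : Λ ≤ 2 * (m : ℝ) ^ 2) (hm : m ≠ 0) (hr : M < r) :
    critPoly M M (m / (2 * M)) m Λ r < 0 := by
  rw [critPoly_corner]
  have hm2 : 0 < (m : ℝ) ^ 2 := by
    have : (m : ℝ) ≠ 0 := Int.cast_ne_zero.2 hm
    positivity
  have ht : 0 < r - M := sub_pos.2 hr
  have hB : 0 < Λ * r ^ 2 + (3 * (m : ℝ) ^ 2 - 2 * Λ) * M * r + ((m : ℝ) ^ 2 - Λ) * M ^ 2 := by
    rw [cornerQuad_eq]
    have h1 : 0 ≤ Λ * (r - M) ^ 2 := by positivity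
    have h2 : 0 < 3 * (m : ℝ) ^ 2 * M * (r - M) := by positivity
    have h3 : 0 ≤ 2 * M ^ 2 * (2 * (m : ℝ) ^ 2 - Λ) := by
      have : 0 ≤ 2 * (m : ℝ) ^ 2 - Λ := sub_nonneg.2 hΛ
      positivity
    linarith
  linarith [mul_pos ht hB]

/-- **Above the dividing line: exactly one critical point, a maximum.** For `0 < M` and `Λ > 2m²`
there is `r_c ∈ (M, (1 + √2)M]`, a root of the corner quadratic `B` (its larger root), with
`P > 0` on `(M, r_c)`, `P(r_c) = 0` and `P < 0` on `(r_c, ∞)`: `B(M) = 2M²(2m² − Λ) < 0 ≤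
B((1 + √2)M)` and `B` is strictly increasing on `[M, ∞)` (intermediate value theorem), and
`P = −2(r − M)B`. DRSR arXiv:1402.7034, proof of Lemma 6.3.1 (case (b)) and Lemma 6.5.1 (the
radius `(1 + √2)M`), specialised to `a = M`, `ω = m/(2M)`.
[cite: DafermosRodnianskiShlapentokhrothman2014, Lemma 6.3.1 (proof)] -/
theorem critPoly_corner_sign_of_lt {M Λ : ℝ} {m : ℤ} (hM : 0 < M) (hΛ : 2 * (m : ℝ) ^ 2 < Λ) :
    ∃ rc : ℝ, M < rc ∧ (∀ r ∈ Ioo M rc, 0 < critPoly M M (m / (2 * M)) m Λ r) ∧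
      critPoly M M (m / (2 * M)) m Λ rc = 0 ∧ (∀ r, rc < r → critPoly M M (m / (2 * M)) m Λ r < 0) ∧
      Λ * rc ^ 2 + (3 * (m : ℝ) ^ 2 - 2 * Λ) * M * rc + ((m : ℝ) ^ 2 - Λ) * M ^ 2 = 0 ∧
      rc ≤ (1 + Real.sqrt 2) * M := by
  have hΛ0 : 0 < Λ := lt_of_le_of_lt (by positivity) hΛ
  have hBM : Λ * M ^ 2 + (3 * (m : ℝ) ^ 2 - 2 * Λ) * M * M + ((m : ℝ) ^ 2 - Λ) * M ^ 2 < 0 := by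
    rw [cornerQuad_self]
    exact mul_neg_of_pos_of_neg (by positivity) (sub_neg.2 hΛ)
  have hBtop : 0 ≤ Λ * ((1 + Real.sqrt 2) * M) ^ 2 +
      (3 * (m : ℝ) ^ 2 - 2 * Λ) * M * ((1 + Real.sqrt 2) * M) + ((m : ℝ) ^ 2 - Λ) * M ^ 2 := by
    rw [cornerQuad_trappingRadius]
    have := Real.sqrt_nonneg 2
    positivity
  have hMtop : M ≤ (1 + Real.sqrt 2) * M :=
    le_mul_of_one_le_left hM.le (by linarith [Real.sqrt_nonneg 2])
  have hcont : Continuous fun x : ℝ ↦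
      Λ * x ^ 2 + (3 * (m : ℝ) ^ 2 - 2 * Λ) * M * x + ((m : ℝ) ^ 2 - Λ) * M ^ 2 := by
    fun_prop
  obtain ⟨rc, hrc, hBrc⟩ : (0 : ℝ) ∈ (fun x : ℝ ↦
      Λ * x ^ 2 + (3 * (m : ℝ) ^ 2 - 2 * Λ) * M * x + ((m : ℝ) ^ 2 - Λ) * M ^ 2) ''
        Icc M ((1 + Real.sqrt 2) * M) :=
    intermediate_value_Icc hMtop hcont.continuousOn ⟨hBM.le, hBtop⟩
  dsimp only at hBrc
  have hMrc : M < rc := by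
    rcases hrc.1.eq_or_lt with h | h
    · rw [← h] at hBrc
      exact absurd (by linear_combination hBrc) hBM.ne
    · exact h
  refine ⟨rc, hMrc, fun r hr ↦ ?_, ?_, fun r hr ↦ ?_, hBrc, hrc.2⟩
  · rw [critPoly_corner]
    have hBr := (cornerQuad_lt_cornerQuad m hM.le hΛ0 hr.1.le hr.2).trans_eq hBrc
    have hrM : 0 < r - M := sub_pos.2 hr.1
    linarith [mul_neg_of_pos_of_neg hrM hBr]
  · rw [critPoly_corner, hBrc, mul_zero]
  · rw [critPoly_corner]
    have hBr := hBrc.symm.trans_lt (cornerQuad_lt_cornerQuad m hM.le hΛ0 hMrc.le hr)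
    have hrM : 0 < r - M := sub_pos.2 (hMrc.trans hr)
    linarith [mul_pos hrM hBr]

/-! ### Consequences for `V₀` at the corner -/

/-- Below the dividing line (`0 ≤ Λ ≤ 2m²`, `m ≠ 0`, `0 < M`): `dV₀/dr < 0` at every `r > M` for
the corner potential `V₀(M, a = M, ω = m/2M)`. DRSR arXiv:1402.7034, Lemma 6.3.1 (case (a)),
at `a = M`, `ω = m/(2M)`. [cite: DafermosRodnianskiShlapentokhrothman2014, Lemma 6.3.1 (proof)] -/
theorem deriv_sepPotential₀_corner_neg {M Λ r : ℝ} {m : ℤ} (hM : 0 < M) (hΛ0 : 0 ≤ Λ)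
    (hΛ : Λ ≤ 2 * (m : ℝ) ^ 2) (hm : m ≠ 0) (hr : M < r) :
    deriv (sepPotential₀ M M (m / (2 * M)) m Λ) r < 0 :=
  (deriv_sepPotential₀_neg_iff M M (m / (2 * M)) m Λ (hM.trans hr)).2
    (critPoly_corner_neg_of_le hM hΛ0 hΛ hm hr)

/-- Below the dividing line (`0 ≤ Λ ≤ 2m²`, `m ≠ 0`, `0 < M`) the corner potential `V₀` is
strictly decreasing on the whole exterior `(M, ∞)`: no barrier. DRSR arXiv:1402.7034, Lemma 6.3.1
(case (a)), at `a = M`, `ω = m/(2M)`. [cite: DafermosRodnianskiShlapentokhrothman2014, Lemma 6.3.1] -/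
theorem strictAntiOn_sepPotential₀_corner {M Λ : ℝ} {m : ℤ} (hM : 0 < M) (hΛ0 : 0 ≤ Λ)
    (hΛ : Λ ≤ 2 * (m : ℝ) ^ 2) (hm : m ≠ 0) :
    StrictAntiOn (sepPotential₀ M M (m / (2 * M)) m Λ) (Ioi M) :=
  strictAntiOn_of_deriv_neg (convex_Ioi M)
    (continuousOn_sepPotential₀ M M (m / (2 * M)) m Λ (Ioi_subset_Ioi hM.le))
    (by
      rw [interior_Ioi]
      exact fun r hr ↦ deriv_sepPotential₀_corner_neg hM hΛ0 hΛ hm hr)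

/-- Above the dividing line (`Λ > 2m²`, `0 < M`): the corner potential `V₀` has exactly one
critical point `r_c ∈ (M, (1 + √2)M]` on the exterior, with `dV₀/dr > 0` on `(M, r_c)`, `= 0` at
`r_c`, `< 0` on `(r_c, ∞)` — the shape of case (b) of Lemma 6.3.1. DRSR arXiv:1402.7034,
Lemma 6.3.1 (case (b)), at `a = M`, `ω = m/(2M)`.
[cite: DafermosRodnianskiShlapentokhrothman2014, Lemma 6.3.1] -/
theorem sepPotential₀_corner_deriv_sign {M Λ : ℝ} {m : ℤ} (hM : 0 < M)
    (hΛ : 2 * (m : ℝ) ^ 2 < Λ) :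
    ∃ rc : ℝ, M < rc ∧ rc ≤ (1 + Real.sqrt 2) * M ∧
      (∀ r ∈ Ioo M rc, 0 < deriv (sepPotential₀ M M (m / (2 * M)) m Λ) r) ∧
      deriv (sepPotential₀ M M (m / (2 * M)) m Λ) rc = 0 ∧
      ∀ r ∈ Ioi rc, deriv (sepPotential₀ M M (m / (2 * M)) m Λ) r < 0 := by
  obtain ⟨rc, hMrc, hpos, hzero, hneg, -, hle⟩ := critPoly_corner_sign_of_lt hM hΛ
  refine ⟨rc, hMrc, hle, fun r hr ↦ ?_, ?_, fun r hr ↦ ?_⟩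
  · exact (deriv_sepPotential₀_pos_iff M M (m / (2 * M)) m Λ (hM.trans hr.1)).2 (hpos r hr)
  · exact (deriv_sepPotential₀_eq_zero_iff M M (m / (2 * M)) m Λ (hM.trans hMrc)).2 hzero
  · exact (deriv_sepPotential₀_neg_iff M M (m / (2 * M)) m Λ (hM.trans (hMrc.trans hr))).2
      (hneg r hr)

/-- Above the dividing line (`Λ > 2m²`, `0 < M`): the corner potential `V₀` is strictly increasing
on `(M, r_c]`, strictly decreasing on `[r_c, ∞)`, and attains its maximum over `(M, ∞)` at
`r_c ∈ (M, (1 + √2)M]` — a single barrier. DRSR arXiv:1402.7034, Lemma 6.3.1 (case (b)), at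
`a = M`, `ω = m/(2M)`. [cite: DafermosRodnianskiShlapentokhrothman2014, Lemma 6.3.1] -/
theorem sepPotential₀_corner_strictMonoOn_strictAntiOn {M Λ : ℝ} {m : ℤ} (hM : 0 < M)
    (hΛ : 2 * (m : ℝ) ^ 2 < Λ) :
    ∃ rc : ℝ, M < rc ∧ rc ≤ (1 + Real.sqrt 2) * M ∧
      StrictMonoOn (sepPotential₀ M M (m / (2 * M)) m Λ) (Ioc M rc) ∧
      StrictAntiOn (sepPotential₀ M M (m / (2 * M)) m Λ) (Ici rc) ∧
      IsMaxOn (sepPotential₀ M M (m / (2 * M)) m Λ) (Ioi M) rc := by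
  obtain ⟨rc, hMrc, hle, hpos, -, hneg⟩ := sepPotential₀_corner_deriv_sign hM hΛ
  have hcont : ContinuousOn (sepPotential₀ M M (m / (2 * M)) m Λ) (Ioi M) :=
    continuousOn_sepPotential₀ M M (m / (2 * M)) m Λ (Ioi_subset_Ioi hM.le)
  have h1 : StrictMonoOn (sepPotential₀ M M (m / (2 * M)) m Λ) (Ioc M rc) :=
    strictMonoOn_of_deriv_pos (convex_Ioc M rc) (hcont.mono Ioc_subset_Ioi_self)
      (by rw [interior_Ioc]; exact hpos)
  have h2 : StrictAntiOn (sepPotential₀ M M (m / (2 * M)) m Λ) (Ici rc) :=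
    strictAntiOn_of_deriv_neg (convex_Ici rc) (hcont.mono fun x hx ↦ hMrc.trans_le hx)
      (by rw [interior_Ici]; exact hneg)
  refine ⟨rc, hMrc, hle, h1, h2, isMaxOn_iff.2 fun r hr ↦ ?_⟩
  rcases le_or_gt r rc with h | h
  · exact h1.monotoneOn ⟨hr, h⟩ ⟨hMrc, le_rfl⟩ h
  · exact h2.antitoneOn self_mem_Ici (mem_Ici.2 h.le) h.le

/-! ### The threshold energy minus the potential at the corner -/

/-- At the corner the threshold energy `(ω₊m)² = m²/(4M²)` minus `V₀` factors through
`Δ = (r − M)²`: `(m/2M)² − V₀(r) = (r − M)²(m²((r + M)² + 4M²) − 4M²Λ)/(4M²(r² + M²)²)`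
(`M ≠ 0`). In particular `V₀(M) = (ω₊m)²`, and the coefficient of `(r − M)²` at `r = M` is
`(8m²M² − 4M²Λ)/(16M⁶) = (2m² − Λ)/(4M⁴)`. DRSR arXiv:1402.7034, §6.2 (the formula for `V₀`),
specialised to `a = M`, `ω = m/(2M)`. [cite: DafermosRodnianskiShlapentokhrothman2014, §6.2] -/
theorem sq_sub_sepPotential₀_corner {M : ℝ} (hM : M ≠ 0) (m : ℤ) (Λ r : ℝ) :
    (m / (2 * M)) ^ 2 - sepPotential₀ M M (m / (2 * M)) m Λ r =
      (r - M) ^ 2 * ((m : ℝ) ^ 2 * ((r + M) ^ 2 + 4 * M ^ 2) - 4 * M ^ 2 * Λ) /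
        (4 * M ^ 2 * (r ^ 2 + M ^ 2) ^ 2) := by
  have hf : r ^ 2 + M ^ 2 ≠ 0 := by positivity
  unfold sepPotential₀ delta
  field_simp
  ring

/-- Below the dividing line (`Λ ≤ 2m²`, `m ≠ 0`, `0 < M`) the threshold frequency `ω₊m` is
nowhere trapped at the corner: `V₀(r) < (ω₊m)²` for every `r > M` (indeed
`m²((r + M)² + 4M²) − 4M²Λ > 4M²(2m² − Λ) ≥ 0`). Compare DRSR arXiv:1402.7034, Lemma 6.4.2
(superradiant frequencies are not trapped) in the subextremal case.
[cite: DafermosRodnianskiShlapentokhrothman2014, Lemma 6.4.2] -/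
theorem sepPotential₀_corner_lt_sq {M Λ r : ℝ} {m : ℤ} (hM : 0 < M) (hΛ : Λ ≤ 2 * (m : ℝ) ^ 2)
    (hm : m ≠ 0) (hr : M < r) :
    sepPotential₀ M M (m / (2 * M)) m Λ r < (m / (2 * M)) ^ 2 := by
  have hm2 : 0 < (m : ℝ) ^ 2 := by
    have : (m : ℝ) ≠ 0 := Int.cast_ne_zero.2 hm
    positivity
  have hnum : 0 < (m : ℝ) ^ 2 * ((r + M) ^ 2 + 4 * M ^ 2) - 4 * M ^ 2 * Λ := by
    have h4 : 4 * M ^ 2 < (r + M) ^ 2 := by nlinarith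
    nlinarith [mul_lt_mul_of_pos_left h4 hm2, mul_nonneg (sq_nonneg M) (sub_nonneg.2 hΛ)]
  have hpos : 0 < (r - M) ^ 2 * ((m : ℝ) ^ 2 * ((r + M) ^ 2 + 4 * M ^ 2) - 4 * M ^ 2 * Λ) /
      (4 * M ^ 2 * (r ^ 2 + M ^ 2) ^ 2) := by
    have : 0 < (r - M) ^ 2 := by
      have : r - M ≠ 0 := sub_ne_zero.2 hr.ne'
      positivity
    positivity
  rw [← sq_sub_sepPotential₀_corner hM.ne'] at hpos
  exact sub_pos.1 hpos

end Kerr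

end Literature.Geometry.Lorentzian

end
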